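import Summits.AnomalousDissipation.AnomalousDissipation.Theses.MirrorVariety
import Literature.Analysis.FluidPDE.SteadyNavierStokesProofs
import Literature.Analysis.FluidPDE.SteadyNavierStokesEnergy
import Literature.Analysis.FunctionSpaces.TorusFourierCalculus

/-!
# Route MirrorVariety (AnomalousDissipation) — `FixedViscosityTransfer`

Settles stmt-AnomalousDissipation-2991 (support item `FixedViscosityTransfer` of route
`AnomalousDissipation/MirrorVariety`): at a FIXED viscosity `ν > 0` and for a smooth divergence-free mean-zero
force `f` on `T³`, loud bounded Fourier–Galerkin steady states at infinitely many resolutions `N`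
(smooth, divergence-free, mean-zero, band-limited to `0 < |k| ≤ N`, solving the tested Galerkin equations
`∫ ⟪U,(U·∇)a⟫ + ν⟪U,Δa⟫ + ⟪f,a⟫ = 0` for all band-limited smooth divergence-free `a`, with `∫ |U|² ≤ E` and
`ν ‖∇U‖² ≥ ε`) produce a steady weak solution `u ∈ V` of the forced Navier–Stokes equations with
`∫ |u|² ≤ E`, `(u, f) ≥ ε` and the energy equation `ν ‖∇u‖² = (u, f)`.

The proof is Temam's existence proof (Temam 1979, Ch. II §1, Thm. 1.2, proof part (ii)–(iii);
Constantin–Foias 1988, Ch. 8, (8.10)–(8.17)) run on the GIVEN Galerkin zeros instead of the Brouwer ones,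
assembled from tree material:

1. extract a sequence of resolutions `N_n ↑ ∞` carrying such states `U_n` (`Filter.extraction_of_frequently_atTop`);
2. testing with `a = U_n` gives the Galerkin energy identity `ν ‖∇U_n‖² = ∫ ⟪f, U_n⟫`
   (`galerkin_energy_identity_of_tested`: `∫ ⟪(U·∇)U, U⟫ = 0`, `∫ ⟪U, ΔU⟫ = -‖∇U‖²`), whence by
   Cauchy–Schwarz the uniform enstrophy bound `‖∇U_n‖² ≤ √E ‖f‖_{L²} / ν`;
3. the classes of the `U_n` lie in a compact enstrophy ball of `H` (Rellich on the torus energy space,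
   `Torus.isCompact_setOf_eGradNormSq_le`), so a subsequence converges in `H = L²_σ` to some `u`, which has finite
   enstrophy (`u ∈ V`);
4. `u` is a steady weak solution exactly as in `Torus.exists_mem_energySpaceV_isSteadyWeakSolution`
   (pass to the limit against band-limited test fields, `Torus.tendsto_integral_weakForm_of_tendsto_lintegral`,
   then remove the truncation of the test field, `Torus.tendsto_integral_weakForm_fourierTruncate`);
5. `∫ |u|² ≤ E` and `(u, f) = lim (U_n, f) = lim ν ‖∇U_n‖² ≥ ε` by strong `L²` convergence;
6. the energy equation of the limit is the discharged fact `Torus.IsSteadyWeakSolution.energy_eq'` (`d = 3 ≤ 4`).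

References: R. Temam, *Navier–Stokes Equations* (1979), Ch. II §1 Thm. 1.2; P. Constantin, C. Foias,
*Navier–Stokes Equations* (1988), Ch. 8; J. C. Robinson, J. L. Rodrigo, W. Sadowski,
*The Three-Dimensional Navier–Stokes Equations* (2016), Thm. 4.4.
-/

-- `Summit.<Summit>.<Problem>` is the tree's mandated summit-side namespace (CONVENTIONS §2); for this
-- single-conjunct summit the two coincide, so the duplicate is deliberate.
set_option linter.dupNamespace false

noncomputable section

open MeasureTheory Filter Topology UnitAddTorus Set
open scoped InnerProductSpace RealInnerProductSpace ENNReal NNReal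

namespace Summit.AnomalousDissipation.AnomalousDissipation.Theorems

open Literature.Analysis.FunctionSpaces Literature.Analysis.FunctionSpaces.Torus
open Literature.Analysis.FluidPDE.Torus

/-- **Galerkin energy identity on a given zero** (Temam 1979, Ch. II §1, (1.29): take `v = u_m` in the
Galerkin equations). If `U` is smooth and divergence free, `f ∈ L²`, and the tested steady equation holds
with the test field `a = U` itself, `∫ (⟪U,(U·∇)U⟫ + ν ⟪U,ΔU⟫ + ⟪f,U⟫) = 0`, then `ν ‖∇U‖² = ∫ ⟪f, U⟫`
(`∫ ⟪(U·∇)U, U⟫ = 0` and `∫ ⟪U, ΔU⟫ = -‖∇U‖²`). [folklore] -/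
theorem galerkin_energy_identity_of_tested {d : Type*} [Fintype d] [DecidableEq d] {ν : ℝ}
    {f U : UnitAddTorus d → EuclideanSpace ℝ d} (hf : MemLp f 2 volume) (hU : IsSmooth U)
    (hdiv : IsDivFree U)
    (htest : ∫ x, (⟪U x, Torus.convect U U x⟫_ℝ + ν * ⟪U x, Torus.laplacian U x⟫_ℝ +
      ⟪f x, U x⟫_ℝ) = 0) :
    ν * gradNormSq U = ∫ x, ⟪f x, U x⟫_ℝ := by
  have hUm : MemLp U 2 volume := hU.memLp 2
  rw [integral_weakForm_eq ν hf hUm hU] at htest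
  have hconv : ∫ x, ⟪Torus.fderiv U x (U x), U x⟫_ℝ = 0 :=
    integral_inner_convect_self_eq_zero hU hdiv
  have hint : ∀ i, Integrable (fun x => ‖partialDeriv i U x‖ ^ 2) volume := fun i =>
    ((hU.partialDeriv i).continuous.norm.pow 2).integrable_unitAddTorus
  have hlap : ∫ x, ⟪U x, Torus.laplacian U x⟫_ℝ = -gradNormSq U := by
    rw [integral_inner_laplacian_eq_neg_holds hU, gradNormSq,
      integral_finsetSum _ fun i _ => hint i]
  rw [hconv, hlap, add_zero] at htest
  linear_combination -htest

/-- Settles stmt-AnomalousDissipation-2991 (`MirrorVariety.FixedViscosityTransfer`): at fixed `ν > 0`,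
loud bounded Galerkin steady states at infinitely many resolutions yield a steady weak solution `u ∈ V` with
`∫ |u|² ≤ E`, `(u, f) ≥ ε` and the energy equation `ν ‖∇u‖² = (u, f)` — Temam's Galerkin existence proof
(Temam 1979, Ch. II Thm. 1.2 (ii)–(iii); Constantin–Foias 1988, Ch. 8 (8.10)–(8.17)) run on the given zeros,
plus the energy equation of steady weak solutions in `d ≤ 4` (Temam 1979, Ch. II (1.21)–(1.22)).
[cite: Temam1979, Ch. II Thm. 1.2] -/
theorem FixedViscosityTransfer_proof :
    Summit.AnomalousDissipation.AnomalousDissipation.Theses.MirrorVariety.FixedViscosityTransfer := by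
  intro ν E ε f hν hf _hfdiv _hfmean hfreq
  -- Step 0: a sequence of resolutions carrying loud bounded Galerkin states
  obtain ⟨Nseq, hNmono, hNP⟩ := Filter.extraction_of_frequently_atTop hfreq
  choose U hU using hNP
  have hUs : ∀ n, IsSmooth (U n) := fun n => (hU n).1.1
  have hUdiv : ∀ n, IsDivFree (U n) := fun n => (hU n).1.2.1
  have hUmean : ∀ n, HasZeroMean (U n) := fun n => (hU n).1.2.2.1
  have hUband : ∀ n, ∀ k ∉ (freqBall (Nseq n)).erase (0 : Fin 3 → ℤ),
      mFourierCoeff (EuclideanSpace.complexify ∘ U n) k = 0 := fun n => (hU n).1.2.2.2.1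
  have hUtest := fun n => (hU n).1.2.2.2.2
  have hUE : ∀ n, ∫ x, ‖U n x‖ ^ 2 ≤ E := fun n => (hU n).2.1
  have hUε : ∀ n, ε ≤ ν * gradNormSq (U n) := fun n => (hU n).2.2
  have hf2 : MemLp f 2 volume := hf.memLp 2
  have hUm : ∀ n, MemLp (U n) 2 volume := fun n => (hUs n).memLp 2
  -- Step 1: the Galerkin energy identity on the given zeros
  have hEn : ∀ n, ν * gradNormSq (U n) = ∫ x, ⟪f x, U n x⟫_ℝ := fun n =>
    galerkin_energy_identity_of_tested hf2 (hUs n) (hUdiv n)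
      (hUtest n (U n) (hUs n) (hUdiv n) (hUband n))
  -- Step 2: the states as elements of `H`
  have hmem : ∀ n, (hUm n).toLp (U n) ∈ energySpace (Fin 3) := fun n =>
    smoothSolenoidal_subset_energySpace ⟨U n, hUs n, hUdiv n, hUmean n, (hUm n).coeFn_toLp⟩
  set v : ℕ → energySpace (Fin 3) := fun n => ⟨(hUm n).toLp (U n), hmem n⟩ with hv
  have hvae : ∀ n, ((v n).1 : UnitAddTorus (Fin 3) → EuclideanSpace ℝ (Fin 3)) =ᵐ[volume] U n :=
    fun n => (hUm n).coeFn_toLp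
  have hpair : ∀ n, pairing (v n).1 f = ∫ x, ⟪f x, U n x⟫_ℝ := fun n => by
    unfold pairing
    refine integral_congr_ae ?_
    filter_upwards [hvae n] with x hx
    rw [hx, real_inner_comm]
  have hnorm : ∀ n, ‖(v n).1‖ ^ 2 = ∫ x, ‖U n x‖ ^ 2 := fun n => by
    rw [← integral_norm_sq_coe_eq (v n).1]
    refine integral_congr_ae ?_
    filter_upwards [hvae n] with x hx
    rw [hx]
  have hnormE : ∀ n, ‖(v n).1‖ ^ 2 ≤ E := fun n => (hnorm n).le.trans (hUE n)
  have hnormE' : ∀ n, ‖(v n).1‖ ≤ Real.sqrt E := fun n =>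
    (le_abs_self _).trans (Real.abs_le_sqrt (hnormE n))
  -- Cauchy–Schwarz: `(U_n, f) ≤ √E ‖f‖`, hence the uniform enstrophy bound
  have hCS : ∀ n, pairing (v n).1 f ≤ Real.sqrt E * ‖hf2.toLp f‖ := fun n => by
    rw [pairing_eq_inner hf2]
    calc ⟪(v n).1, hf2.toLp f⟫_ℝ ≤ ‖(v n).1‖ * ‖hf2.toLp f‖ := real_inner_le_norm _ _
      _ ≤ Real.sqrt E * ‖hf2.toLp f‖ := mul_le_mul_of_nonneg_right (hnormE' n) (norm_nonneg _)
  have hgradΛ : ∀ n, gradNormSq (U n) ≤ Real.sqrt E * ‖hf2.toLp f‖ / ν := fun n => by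
    rw [le_div_iff₀ hν]
    calc gradNormSq (U n) * ν = pairing (v n).1 f := by rw [mul_comm, hEn n, hpair n]
      _ ≤ Real.sqrt E * ‖hf2.toLp f‖ := hCS n
  have heGradΛ : ∀ n, eGradNormSq (U n) ≤ ENNReal.ofReal (Real.sqrt E * ‖hf2.toLp f‖ / ν) :=
    fun n => by
    rw [eGradNormSq_eq_ofReal_gradNormSq (hUs n)]
    exact ENNReal.ofReal_le_ofReal (hgradΛ n)
  have hUB : ∀ n, ∫⁻ x, ‖U n x‖ₑ ^ 2 ≤ ENNReal.ofReal E := fun n => by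
    rw [lintegral_enorm_sq_eq_ofReal (hUm n)]
    exact ENNReal.ofReal_le_ofReal (hUE n)
  -- Step 3: compactness of the enstrophy ball (Rellich) and the limit `u ∈ V`
  set K : Set (energySpace (Fin 3)) :=
    {w | eGradNormSq (w.1 : UnitAddTorus (Fin 3) → EuclideanSpace ℝ (Fin 3)) ≤
      ENNReal.ofReal (Real.sqrt E * ‖hf2.toLp f‖ / ν)} with hK
  have hKc : IsCompact K := isCompact_setOf_eGradNormSq_le ENNReal.ofReal_ne_top
  have hvK : ∀ n, v n ∈ K := fun n => by
    show eGradNormSq ((v n).1 : UnitAddTorus (Fin 3) → EuclideanSpace ℝ (Fin 3)) ≤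
      ENNReal.ofReal (Real.sqrt E * ‖hf2.toLp f‖ / ν)
    rw [eGradNormSq_congr_ae_field (hvae n)]
    exact heGradΛ n
  obtain ⟨u, huK, φ, hφ, hlim⟩ := hKc.tendsto_subseq hvK
  have huL2 : MemLp (u.1 : UnitAddTorus (Fin 3) → EuclideanSpace ℝ (Fin 3)) 2 volume := Lp.memLp _
  have huG : eGradNormSq (u.1 : UnitAddTorus (Fin 3) → EuclideanSpace ℝ (Fin 3)) ≤
      ENNReal.ofReal (Real.sqrt E * ‖hf2.toLp f‖ / ν) := huK
  have huV : u.1 ∈ energySpaceV (Fin 3) :=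
    ⟨u.2, memSobolev_one_complexify_of_eGradNormSq_ne_top huL2
      (ne_top_of_le_ne_top ENNReal.ofReal_ne_top huG)⟩
  -- strong convergence in `L²` along the subsequence
  have h1 : Tendsto (fun j => (v (φ j)).1) atTop (𝓝 u.1) :=
    (continuous_subtype_val.tendsto u).comp hlim
  have hconv : Tendsto (fun j => ∫⁻ x,
      ‖U (φ j) x - (u.1 : UnitAddTorus (Fin 3) → EuclideanSpace ℝ (Fin 3)) x‖ₑ ^ 2)
      atTop (𝓝 0) := by
    have h2 := tendsto_iff_norm_sub_tendsto_zero.1 h1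
    have h3 : Tendsto (fun j => ‖(v (φ j)).1 - u.1‖ₑ ^ 2) atTop (𝓝 0) := by
      have h4 := ENNReal.tendsto_ofReal h2
      rw [ENNReal.ofReal_zero] at h4
      have h5 := ((ENNReal.continuous_pow 2).tendsto 0).comp h4
      rw [zero_pow two_ne_zero] at h5
      refine h5.congr fun j => ?_
      simp only [Function.comp_apply, ofReal_norm]
    refine h3.congr fun j => ?_
    rw [← lintegral_enorm_coe_sub_coe_sq]
    refine lintegral_congr_ae ?_
    filter_upwards [hvae (φ j)] with x hx
    rw [hx]
  -- Step 4: the limit is a steady weak solution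
  have hweak : IsSteadyWeakSolution ν f u := by
    intro w hw hwdiv hwmean
    -- against the truncations `P_M w`
    have htrunc : ∀ M : ℕ, ∫ x, (⟪(u.1 : UnitAddTorus (Fin 3) → EuclideanSpace ℝ (Fin 3)) x,
        Torus.convect (u.1 : UnitAddTorus (Fin 3) → EuclideanSpace ℝ (Fin 3))
          (fourierTruncate M w) x⟫_ℝ +
        ν * ⟪(u.1 : UnitAddTorus (Fin 3) → EuclideanSpace ℝ (Fin 3)) x,
          Torus.laplacian (fourierTruncate M w) x⟫_ℝ +
        ⟪f x, fourierTruncate M w x⟫_ℝ) = 0 := by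
      intro M
      have ha : IsSmooth (fourierTruncate M w) := isSmooth_fourierTruncate M w
      have hadiv : IsDivFree (fourierTruncate M w) :=
        isDivFree_realTrigPoly (hwdiv.isTransversal_mFourierCoeff hw (freqBall M))
      have hw0 : mFourierCoeff (EuclideanSpace.complexify ∘ w) 0 = 0 := by
        rw [mFourierCoeff_eq_integral_volume]
        simp only [neg_zero, mFourier_zero, ContinuousMap.one_apply, one_smul, Function.comp_apply]
        rw [EuclideanSpace.complexify.integral_comp_comm w, hwmean, map_zero]
      have hband : ∀ N, M ≤ N → ∀ k ∉ (freqBall (d := Fin 3) N).erase 0,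
          mFourierCoeff (EuclideanSpace.complexify ∘ fourierTruncate M w) k = 0 := by
        intro N hMN k hk
        rw [mFourierCoeff_fourierTruncate hw.integrable]
        by_cases hkM : k ∈ freqBall M
        · have hk0 : k = 0 := by
            by_contra h
            exact hk (Finset.mem_erase.2 ⟨h, freqBall_mono hMN hkM⟩)
          subst hk0
          rw [if_pos hkM, hw0]
        · rw [if_neg hkM]
      have hev : ∀ᶠ j in atTop,
          ∫ x, (⟪U (φ j) x, Torus.convect (U (φ j)) (fourierTruncate M w) x⟫_ℝ +
            ν * ⟪U (φ j) x, Torus.laplacian (fourierTruncate M w) x⟫_ℝ +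
            ⟪f x, fourierTruncate M w x⟫_ℝ) = 0 := by
        filter_upwards [eventually_ge_atTop M] with j hj
        exact hUtest (φ j) _ ha hadiv
          (hband (Nseq (φ j)) ((hj.trans (hφ.id_le j)).trans (hNmono.id_le _)))
      have hl := tendsto_integral_weakForm_of_tendsto_lintegral (ν := ν) hf2 (fun n => hUm (φ n))
        huL2 ENNReal.ofReal_ne_top (fun n => hUB (φ n)) hconv ha
      exact tendsto_nhds_unique hl (tendsto_const_nhds.congr' (hev.mono fun j hj => hj.symm))
    -- remove the truncation
    have hl2 := tendsto_integral_weakForm_fourierTruncate ν hf2 huL2 hw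
    have hzero : ∫ x, (⟪(u.1 : UnitAddTorus (Fin 3) → EuclideanSpace ℝ (Fin 3)) x,
        Torus.convect (u.1 : UnitAddTorus (Fin 3) → EuclideanSpace ℝ (Fin 3)) w x⟫_ℝ +
        ν * ⟪(u.1 : UnitAddTorus (Fin 3) → EuclideanSpace ℝ (Fin 3)) x, Torus.laplacian w x⟫_ℝ +
        ⟪f x, w x⟫_ℝ) = 0 :=
      tendsto_nhds_unique hl2 (tendsto_const_nhds.congr fun M => (htrunc M).symm)
    have hfinal : nsGeneratorPairing ν f u w =
        ∫ x, (⟪(u.1 : UnitAddTorus (Fin 3) → EuclideanSpace ℝ (Fin 3)) x,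
          Torus.convect (u.1 : UnitAddTorus (Fin 3) → EuclideanSpace ℝ (Fin 3)) w x⟫_ℝ +
          ν * ⟪(u.1 : UnitAddTorus (Fin 3) → EuclideanSpace ℝ (Fin 3)) x, Torus.laplacian w x⟫_ℝ +
          ⟪f x, w x⟫_ℝ) := by
      rw [integral_weakForm_eq ν hf2 huL2 hw]
      rfl
    rw [hfinal]
    exact hzero
  -- Step 5: the bounds pass to the limit by strong `L²` convergence
  have hnorm_lim : Tendsto (fun j => ‖(v (φ j)).1‖ ^ 2) atTop (𝓝 (‖u.1‖ ^ 2)) :=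
    h1.norm.pow 2
  have huE : ‖u.1‖ ^ 2 ≤ E := le_of_tendsto' hnorm_lim fun j => hnormE (φ j)
  have huE' : ∫ x, ‖(u.1 : UnitAddTorus (Fin 3) → EuclideanSpace ℝ (Fin 3)) x‖ ^ 2 ≤ E := by
    rw [integral_norm_sq_coe_eq]
    exact huE
  have hpair_lim : Tendsto (fun j => pairing (v (φ j)).1 f) atTop (𝓝 (pairing u.1 f)) := by
    have h := Filter.Tendsto.inner (𝕜 := ℝ) h1 (tendsto_const_nhds (x := hf2.toLp f))
    rw [← pairing_eq_inner hf2] at h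
    refine h.congr fun j => ?_
    rw [← pairing_eq_inner hf2]
  have hεpair : ∀ j, ε ≤ pairing (v (φ j)).1 f := fun j => by
    rw [hpair, ← hEn]
    exact hUε (φ j)
  have huε : ε ≤ pairing u.1 f := ge_of_tendsto' hpair_lim hεpair
  -- Step 6: the energy equation of the limit (`d = 3 ≤ 4`)
  exact ⟨u, huV, hweak, huE', huε, IsSteadyWeakSolution.energy_eq' (by simp) hf2 huV hweak⟩

end Summit.AnomalousDissipation.AnomalousDissipation.Theorems

end
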